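import Literature.IUT.HodgeArakelov.ThetaSettingHextPureExtensionAtModelTate
import Literature.IUT.HodgeArakelov.ThetaSettingDeltaCharacteristicEtThThm510
import HarnessLib

/-!
# [EtTh] Theorem 5.10 (ii) ∧ (iii): the clause «`Δ^tp_X̲̲ ⊆ Π^tp_X̲̲` is characteristic» (`hΔX`) IS A THEOREM at the stage-2 Tate model
# of the §1 root — for EVERY étale-theta datum and EVERY `X̲̲`-choice (proof-only knit of landed theorems)

S. Mochizuki, *The étale theta function and its Frobenioid-theoretic manifestations*, Publ. RIMS **45** (2009), Thm. 5.10 (iii),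
proof, p. 335 (PDF p. 109): the representative of the `Π^tp_X`-conjugacy class of automorphisms of `Π^tp_X̲̲` induced by `Ψ^bs` is chosen
«up to composition with an automorphism of the topological group `Π^tp_Ÿ̲` that extends to an automorphism of the topological group `Π^tp_X`»;
such automorphisms carry `Δ^tp` onto itself «[cf. [Mzk2], Lemma 1.3.8]» (proof of Thm. 1.6, p. 250 (PDF p. 24); Prop. 2.4, p. 264 (PDF p. 38)).
[cite: MochizukiEtTh2009, Thm 5.10 (iii) p.335 (PDF p.109)]

abc-iut cell, layer L2 = [EtTh], seat abc-iut-L2-t12 (gen 15).  PROOF-ONLY (class (a): 0 `def` / 0 `instance` / 0 notation / 0 `Prop`-valued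
definition / 0 `sorry`; nothing landed is edited or restated).

WHY THIS FILE.  abc-iut-w6-d053's F-0620-free END forms of Theorem 5.10 (ii) ∧ (iii) at the Ÿ̲̲-junction
(`Discharge/Sec5Thm510iiiOfThetaSettingYddOfDeltaCharacteristic`, p492406) display ONE clause about the tempered group: `hψΔ` / `hΔX` / `hextΔ`
(«the representative `ψY` carries `Δ^tp_X̲̲` onto itself» / «`Δ^tp_X̲̲ ⊆ Π^tp_X̲̲` characteristic» / the Prop. 2.4-shape extension property).
Its stage-2 Tate-model supplier of record in the L2 books (`thm510_ii_iii_ofThetaSettingYdd_modelχq_of_ker_ne_bot_canonical`,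
`ThetaSettingDeltaCharacteristicEtThThm510`) still displays `{U, hU, eΔ, hI0}`.  Since then the layer-L6 (H1) chain CLOSED those binders:
abc-iut-w4-d044's ★ `SettingModel.deltaX_characteristic_ofDoubleUnderline_modelχq_holds` (`ThetaSettingDeltaCharacteristicAtModelTateUnconditional`,
`hI0 := ker_tatePairHom_ne_bot`, `eΔ :=` the GeomIdent package) is UNCONDITIONAL at the [IUTchII] §1 setting `S := ofDoubleUnderline C μ …`
of every `X̲̲`-choice `C` over `modelχq p i j`, and abc-iut-L6-t13's `ThetaSettingHextPureExtensionAtModelTate` §1 supplies the side DATA of `S`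
from the tree (`compat_modelχq`, `ThetaSetting.modelχq_sec2Hyps`, `modelχq_exists_cyclotomeMod_family`, the root cocycle `rootLift`,
`EtaleLevels.eta0_mem`).  NO [EtTh]-vocabulary consumer of that closure existed; this file is it.

WHAT IS SHOWN (EVERY prime `p`, EVERY `i j` (`j` even), EVERY étale-theta datum `E` over `D := ThetaSetting.modelχq p i j hj`, EVERY
`X̲̲`-choice `C : E.DoubleUnderline l`):
* §1 `SettingModel.isTopCharacteristic_deltaTemp_subgroupOf_Huu_modelχq` — **`IsTopCharacteristic C.Huu (D.DeltaTemp.subgroupOf C.Huu)`**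
  ([EtTh] Def. 3.3's «characteristic»: every automorphism of the topological group `Π^tp_X̲̲ = C.Huu` carries `Δ^tp_X̲̲ = Δ^tp_X ∩ Π^tp_X̲̲`
  onto itself) ⟸ ONLY the numeric side conditions of the [IUTchII] §1 setting {`l` prime, `p ≠ 2`, `p ≠ l`, `ζ_{4l} ∈ K = ℚ_p`};
  `…_record` — the same ⟸ {`l` prime, `4·l ∣ p − 1`} (abc-iut-L6's `ModelTateCarriers.ne_two_of_four_mul_dvd_pred` / `ne_of_four_mul_dvd_pred` /
  `exists_isPrimitiveRoot_K_modelχq`).  Composition: w6-d053's bridge `isTopCharacteristic_deltaTemp_subgroupOf_Huu_of_deltaX_ofDoubleUnderline`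
  (abc-iut-w4-d043's `ThetaSetting.deltaX_ofDoubleUnderline_eq`: `Δ^{(S)} = Δ^tp_X ∩ Π^tp_X̲̲`) ∘ w4-d044's `_holds`.
* §1 also: `map_deltaTemp_subgroupOf_Huu_eq_modelχq(_record)` — the clause `hψΔ` for ONE (every) `ψY`, literal shape of the END forms.

RESIDUAL OF RECORD (numbers, not adjectives): §1 displays {`hl`, `hp2`, `hpl`, `hζ`} resp. {`hl`, `hdvd : 4 * l ∣ p - 1`} and NOTHING ELSE —
NO `eΔ`/`hI0`/`U`/`hU`, NO F-0007 `PreservesGeom`, NO F-0001 regime, NO F-0620/`h15`/`L`.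
HONEST FRAMING: `modelχq` is a SEMI-SYNTHETIC model of OUR typed [EtTh] §1 interface (`Π^tp_X := (F̂₂ ×_Ẑ ℤ) ⋊ G_{ℚ_p}` with the Tate shear;
not the tempered `π₁` of a curve) — a statement about OUR model, kernel-checked from landed theorems (classical profinite group theory, slimness /
elasticity of `G_{ℚ_p}` proved in the tree); nothing of [EtTh] (refereed) or [IUTchII] (claim key `Mochizuki2012`, disputed) is asserted beyond
that; typed ≠ proved; instantiated ≠ endorsed; no side is taken on [IUTchIII] Cor. 3.12; nothing here says abc is proved or refuted.
-/

noncomputable section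

namespace Literature.AnabelianGeometry.EtaleTheta.SettingModel

open Literature.AnabelianGeometry.SemiGraphs
open Literature.IUT.HodgeArakelov

variable (p : ℕ) [Fact p.Prime] (i j : ℤ) (hj : Even j)

section H1

variable {E : (ThetaSetting.modelχq p i j hj).EtaleThetaData} {l : ℕ} (C : E.DoubleUnderline l)

/-! ### §1. «`Δ^tp_X̲̲ ⊆ Π^tp_X̲̲` characteristic» at the stage-2 Tate model, every `X̲̲`-choice -/

/-- **«`Δ^tp_X̲̲ ⊆ Π^tp_X̲̲` is characteristic» AT THE STAGE-2 TATE MODEL** (the `hΔX` slot of abc-iut-w6-d053's Theorem 5.10 (ii) ∧ (iii)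
END form `thm510_ii_iii_ofThetaSettingYdd_of_isTopCharacteristic_canonical`): for every étale-theta datum `E` over
`D := ThetaSetting.modelχq p i j hj` and every `X̲̲`-choice `C`, every automorphism of the topological group `Π^tp_X̲̲ = C.Huu` carries
`Δ^tp_X̲̲ = Δ^tp_X ∩ Π^tp_X̲̲` onto itself — modulo ONLY the numeric side conditions {`l` prime, `p ≠ 2`, `p ≠ l`, `ζ_{4l} ∈ K`} needed to FORM
the [IUTchII] §1 setting of `C` (its remaining side data — `Compat`, `Sec2Hyps`, a cyclotome family, a theta cocycle — are the tree's, as in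
abc-iut-L6-t13's `right_coe_apply_eq_one_of_right_eq_one`); the (H1) input is abc-iut-w4-d044's UNCONDITIONAL
`deltaX_characteristic_ofDoubleUnderline_modelχq_holds`.  [cite: MochizukiEtTh2009, Thm 5.10 (iii) p.335 (PDF p.109); Def 3.3 (i) p.298 (PDF p.72)]
[cite: MochizukiAbsTopI2012, Thm 2.6 (v) p.22] -/
theorem isTopCharacteristic_deltaTemp_subgroupOf_Huu_modelχq (hl : l.Prime) (hp2 : p ≠ 2) (hpl : p ≠ l)
    (hζ : ∃ ζ : (ThetaSetting.modelχq p i j hj).K, IsPrimitiveRoot ζ (4 * l)) :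
    IsTopCharacteristic C.Huu ((ThetaSetting.modelχq p i j hj).DeltaTemp.subgroupOf C.Huu) := by
  classical
  -- the [IUTchII] §1 side data of `X̲̲` at the model (as in abc-iut-L6-t13's `right_coe_apply_eq_one_of_right_eq_one`)
  have hC : (ThetaSetting.modelχq p i j hj).Compat := compat_modelχq p i j hj
  have hS : (ThetaSetting.modelχq p i j hj).Sec2Hyps := ThetaSetting.modelχq_sec2Hyps p i j hj
  obtain ⟨mods, -⟩ := modelχq_exists_cyclotomeMod_family p i j hj hl.pos
  have hf := ModelTateCarriers.rootLift_mem_rootCocycles C hC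
  have hη := EtaleLevels.eta0_mem C hC hS mods (EtaleThetaDataOfSetting.rootLift C) hf 1
  -- w6-d053's bridge ∘ w4-d044's UNCONDITIONAL (H1) at `S := ofDoubleUnderline C (mods 1) …`
  exact C.isTopCharacteristic_deltaTemp_subgroupOf_Huu_of_deltaX_ofDoubleUnderline (mods 1) hC hS hl hp2 hpl hζ hη
    (deltaX_characteristic_ofDoubleUnderline_modelχq_holds p i j hj C (mods 1) hC hS hl hp2 hpl hζ hη)

/-- **The same AT THE DATUM OF RECORD `4·l ∣ p − 1`** (`l` prime): then `p ≠ 2`, `p ≠ l` and `ζ_{4l} ∈ K = ℚ_p` are the tree's theorems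
(abc-iut-L6's `ModelTateCarriers.ne_two_of_four_mul_dvd_pred`, `ne_of_four_mul_dvd_pred`, `exists_isPrimitiveRoot_K_modelχq`), so
«`Δ^tp_X̲̲ ⊆ Π^tp_X̲̲` characteristic» holds for EVERY étale-theta datum and EVERY `X̲̲`-choice over `modelχq p i j`.
[cite: MochizukiEtTh2009, Thm 5.10 (iii) p.335 (PDF p.109); Def 3.3 (i) p.298 (PDF p.72)] [cite: MochizukiAbsTopI2012, Thm 2.6 (v) p.22] -/
theorem isTopCharacteristic_deltaTemp_subgroupOf_Huu_modelχq_record (hl : l.Prime) (hdvd : 4 * l ∣ p - 1) :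
    IsTopCharacteristic C.Huu ((ThetaSetting.modelχq p i j hj).DeltaTemp.subgroupOf C.Huu) :=
  isTopCharacteristic_deltaTemp_subgroupOf_Huu_modelχq p i j hj C hl (ModelTateCarriers.ne_two_of_four_mul_dvd_pred p hl.pos hdvd)
    (ModelTateCarriers.ne_of_four_mul_dvd_pred p hl.pos hdvd) (ModelTateCarriers.exists_isPrimitiveRoot_K_modelχq p i j hj hl.pos hdvd)

/-- **The clause `hψΔ` of the END form `thm510_ii_iii_ofThetaSettingYdd_of_repDelta_canonical`, for EVERY candidate representative `ψY`**
(literal shape): at the stage-2 Tate model every automorphism `ψ` of the topological group `Π^tp_X̲̲` satisfies `ψ(Δ^tp_X̲̲) = Δ^tp_X̲̲`.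
[cite: MochizukiEtTh2009, Thm 5.10 (iii) p.335 (PDF p.109)] -/
theorem map_deltaTemp_subgroupOf_Huu_eq_modelχq (hl : l.Prime) (hp2 : p ≠ 2) (hpl : p ≠ l)
    (hζ : ∃ ζ : (ThetaSetting.modelχq p i j hj).K, IsPrimitiveRoot ζ (4 * l)) (ψ : ↥C.Huu ≃ₜ* ↥C.Huu) :
    ((ThetaSetting.modelχq p i j hj).DeltaTemp.subgroupOf C.Huu).map ψ.toMulEquiv.toMonoidHom =
      (ThetaSetting.modelχq p i j hj).DeltaTemp.subgroupOf C.Huu :=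
  isTopCharacteristic_deltaTemp_subgroupOf_Huu_modelχq p i j hj C hl hp2 hpl hζ ψ

/-- `hψΔ` for every `ψ`, AT THE DATUM OF RECORD `4·l ∣ p − 1`. [cite: MochizukiEtTh2009, Thm 5.10 (iii) p.335 (PDF p.109)] -/
theorem map_deltaTemp_subgroupOf_Huu_eq_modelχq_record (hl : l.Prime) (hdvd : 4 * l ∣ p - 1) (ψ : ↥C.Huu ≃ₜ* ↥C.Huu) :
    ((ThetaSetting.modelχq p i j hj).DeltaTemp.subgroupOf C.Huu).map ψ.toMulEquiv.toMonoidHom =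
      (ThetaSetting.modelχq p i j hj).DeltaTemp.subgroupOf C.Huu :=
  isTopCharacteristic_deltaTemp_subgroupOf_Huu_modelχq_record p i j hj C hl hdvd ψ

end H1

end Literature.AnabelianGeometry.EtaleTheta.SettingModel

end
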